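/-
Copyright: the b2b-balaban T⁴-continuum CRUX team, row NE7b leaf lineage `t4-ne7b-formalise-leaf-01` (gen 88). Project licence.
-/
import Summits.QuantumFields.BalabanUV.T4Continuum.Spine.NE7b.PerturbedSectionProducts

/-!
# THE CONTROLLED PRODUCT FROM ONE-SHOT DATA: PSP's two-parameter reference hypothesis `‖R a b‖ ≤ C·θ^{b−a}` (ALL consecutive products of the
# reference steps) is DISCHARGED by a ONE-parameter family with left inverses — `R a b := 𝒬_a ∘ S⁰_b`, where `S⁰_b : X b →L X 0` are the reference
# (free) composite sections, `S⁰_{b+1} = S⁰_b ∘ A_b`, and `𝒬_a ∘ S⁰_a = 1` is EXACTLY the clause `(𝒬 k).comp (𝒮 k) = 1` that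
# `…SupEquationTowerSections.tower_eq_sections` (SECS) exports: hence the perturbed composite `P_k = F_0 ∘ ⋯ ∘ F_{k−1}` obeys
# `‖P_k‖ ≤ C·θ^k·∏_{j<k}(1 + C·ε_j∕θ)` and `‖P_k − S⁰_k‖ ≤ C·θ^k·(∏_{j<k}(1 + C·ε_j∕θ) − 1)` from `‖S⁰_b‖ ≤ C·θ^b` (the ONE-SHOT letter) and
# `‖𝒬_a‖ ≤ θ^{−a}` (the blockings) alone — no two-parameter semigroup is ever typed
# (row NE7b, node U5c; sibling of this lineage's `…PerturbedSectionProducts` (PSP, p398230 ✓); Mathlib + PSP only; [folklore])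

Cell `pub-balaban`, sub-cell `t4`, spine estimate NE7b (`T4WeightBudget.RelWeightBound`; the cell's OWN estimate — NOT PRINTED in
[Bałaban 1983–89], NOT PROVED).  Crux-route work under `Spine/NE7b/` by a row leaf (`t4-ne7b-formalise-leaf-01` gen 88) under FREEZE (0)'s
crux-prover clause; NOTHING of Bałaban's is named as a Lean object, valued or asserted; no `T4Continuum/Support` leaf typed; no `def` (the
reference family `R a b := 𝒬_a ∘ S⁰_b` is a λ-term handed to PSP, its recursion equations PROVED here from the one-parameter data); zero `sorry`.
Import: PSP only (through it Mathlib's operator norm, `Real.exp`, `Seminorm`).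

WHY (located).  PSP (`…PerturbedSectionProducts.norm_le_of_consecutive`, chair leaf-04 g164 X-PSP PASS, CLAIMS l.65001) controls the perturbed
tower's composite section by ONE constant for EVERY sub-tower `A_a ∘ ⋯ ∘ A_{b−1}` of the reference steps.  In the sup road the reference steps are
the FREE tower's step sections, and the letter that exists BY NAME is for composites FROM THE FINEST LEVEL: `S⁰_b = 𝒮^{free}_b = DΦ_b(0)` is the
ONE-SHOT section of the composite blocking (leaf-06 SOS `tower_eq_oneShot`, leaf-03 HSGT §5, leaf-04 STG) whose inverse chart ASE bounds at EVERY side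
by the same `N_∞` (the OWNER's (46) `abs_HBZd_le_sup` in the pure-sup currency; truth `≤ 4.45`, PRICING-NE7b F721).  An intermediate sub-tower
`a → b` is NOT a one-shot section of the bare action (it sees the level-`a` EFFECTIVE action) — but it needs no letter of its own: with the composite
blocking `𝒬_a` (SECS: `𝒬 (j+1) = Q_j ∘ 𝒬_j`, `(𝒬 k).comp (𝒮 k) = 1`) one has `R a b = 𝒬_a ∘ S⁰_b` (apply `𝒬_a` to `S⁰_b = S⁰_a ∘ R a b`), so
`‖R a b‖ ≤ ‖𝒬_a‖·‖S⁰_b‖`; block averaging has norm `≤ 1` (rescaled by `L^{(d−2)∕2}` per level: `θ^{−a}` with `θ = L^{−(d−2)∕2}`), and the one-shot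
letter gives `‖S⁰_b‖ ≤ N_∞·θ^b` in the same units.  THIS FILE types that reduction once, abstractly, in PSP's two currencies.

WHAT IS PROVED ([folklore]; `X : ℕ → Type*` real normed spaces; `P S⁰ : ∀ k, X k →L[ℝ] X 0`, `𝒬 : ∀ a, X 0 →L[ℝ] X a`, `F A : ∀ j, X (j+1) →L[ℝ] X j`;
hypotheses `P 0 = 1`, `P (k+1) = P k ∘ F k`, `S⁰ 0 = 1`, `S⁰ (b+1) = S⁰ b ∘ A b`, `𝒬 a ∘ S⁰ a = 1`):
* §1 `blocking_zero` (`𝒬 0 = 1`), `ref_self` (`𝒬 a ∘ S⁰ a = 1` read as PSP's `hR0`), `ref_succ` (`𝒬 a ∘ S⁰ (b+1) = (𝒬 a ∘ S⁰ b) ∘ A b` — PSP's `hR`, for ALL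
  `a, b`), `ref_zero_left` (`𝒬 0 ∘ S⁰ b = S⁰ b`), `inv_pow_mul_pow_eq`, `norm_ref_le` (`0 < θ`, `‖S⁰ b‖ ≤ C·θ^b`, `‖𝒬 a‖ ≤ (θ⁻¹)^a`, `a ≤ b` ⟹
  `‖𝒬 a ∘ S⁰ b‖ ≤ C·θ^{b−a}`),
  `duhamel_oneShot` (`P k = S⁰ k + Σ_{j<k} (P j ∘ (F j − A j)) ∘ (𝒬 (j+1) ∘ S⁰ k)`).
* §2 OPERATOR NORM: **`norm_le_of_oneShot`** (`‖P k‖ ≤ C·θ^k·∏_{j<k}(1 + C·ε_j∕θ)`), **`norm_sub_oneShot_le`** (`‖P k − S⁰ k‖ ≤ C·θ^k·(∏_{j<k}(1 + C·ε_j∕θ) − 1)`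
  — the interacting composite section minus the FREE ONE-SHOT section), `norm_le_geometric_of_oneShot` (`ε_j ≤ e` ⟹ `‖P k‖ ≤ C·(θ + C·e)^k`),
  `norm_le_uniform_of_oneShot` (`θ = 1`, `‖𝒬 a‖ ≤ 1`, `‖S⁰ b‖ ≤ C`, `Σ_{j<k} ε_j ≤ E` ⟹ `‖P k‖ ≤ C·exp(C·E)` for every `k`).
* §3 SECOND CURRENCY (`p : ∀ k, Seminorm ℝ (X k)`): `seminorm_ref_le`, **`seminorm_le_of_oneShot`** (`p_a(𝒬 a x) ≤ (θ⁻¹)^a·p_0 x`, `p_0(S⁰ b v) ≤ C·θ^b·p_b v`,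
  `p_j((F j − A j) v) ≤ ε_j·p_{j+1} v` ⟹ `p_0(P k v) ≤ C·θ^k·∏_{j<k}(1 + C·ε_j∕θ)·p_k v`).
* §4 toy (`X k = ℝ`, everything `1`, `ε = 0`).

HONEST (what this is NOT).  Abstract; the ℓ^∞ ∕ weighted INSTANCE (`S⁰ := 𝒮^{free}`, `𝒬 :=` composite block averaging, `F := T⁻¹∘inl` interacting,
`A :=` free step sections, `ε_j` from (63)∕(64), `C := N_∞`, `θ := L^{−(d−2)∕2}`) is the OWNER's ∕ leaf-06's junction (SOSW ∕ TOWERW), NOT typed here; by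
value `N_∞` is astronomical ⇒ G15-consumable only (truth: `C = 4.45`, `θ = 1∕2` at `L = 2`, `d = 4` ⇒ the free-plus-`ε` tower contracts iff `ε < 0.112`
per step in rescaled sup operator norm — a reading, not a theorem); nothing of (A3) ∕ (A1c) ∕ NC-NE7b-α; BY-NAME EFFECT ON THE WALL: NONE.  NE7b NOT
PRINTED ∕ NOT PROVED; spine PROVED 0∕9; rung (B)+1 on a FINITE torus — NOT infinite volume, NOT the mass gap, NOT Clay.  HONEST DEPENDENCY: continuum YM
on T⁴ ⇐ BetaPertH ∧ nine spine estimates (0∕9 proved); BetaPertH ⇐ (D1) ∧ (D4) ∧ CAP+tail; G-an2-4 gates asym, D1 and NE2∕3∕4.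
-/

set_option autoImplicit false

namespace Summit.QuantumFields.BalabanUV.T4Continuum.NE7b.PerturbedSectionProductsOneShot

open Finset
open Summit.QuantumFields.BalabanUV.T4Continuum.NE7b.PerturbedSectionProducts

variable {X : ℕ → Type*} [∀ k, NormedAddCommGroup (X k)] [∀ k, NormedSpace ℝ (X k)]

/-! ## §1. The reference family `R a b := 𝒬 a ∘ S⁰ b` satisfies PSP's hypotheses -/

/-- `𝒬 0 = 1`: the level-`0` blocking is a left inverse of `S⁰ 0 = 1`. [folklore] -/
theorem blocking_zero (S0 : ∀ b, X b →L[ℝ] X 0) (𝒬 : ∀ a, X 0 →L[ℝ] X a)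
    (hS00 : S0 0 = ContinuousLinearMap.id ℝ (X 0)) (h𝒬S : ∀ a, (𝒬 a).comp (S0 a) = ContinuousLinearMap.id ℝ (X a)) :
    𝒬 0 = ContinuousLinearMap.id ℝ (X 0) := by
  have h := h𝒬S 0
  rwa [hS00, ContinuousLinearMap.comp_id] at h

/-- PSP's `hR0` for `R a b := 𝒬 a ∘ S⁰ b`. [folklore] -/
theorem ref_self (S0 : ∀ b, X b →L[ℝ] X 0) (𝒬 : ∀ a, X 0 →L[ℝ] X a)
    (h𝒬S : ∀ a, (𝒬 a).comp (S0 a) = ContinuousLinearMap.id ℝ (X a)) (a : ℕ) :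
    (fun a b => (𝒬 a).comp (S0 b)) a a = ContinuousLinearMap.id ℝ (X a) := h𝒬S a

/-- PSP's `hR` for `R a b := 𝒬 a ∘ S⁰ b`, for ALL `a, b` (no order needed): `𝒬 a ∘ S⁰ (b+1) = (𝒬 a ∘ S⁰ b) ∘ A b`. [folklore] -/
theorem ref_succ (S0 : ∀ b, X b →L[ℝ] X 0) (𝒬 : ∀ a, X 0 →L[ℝ] X a) (A : ∀ j, X (j + 1) →L[ℝ] X j)
    (hS0 : ∀ b, S0 (b + 1) = (S0 b).comp (A b)) (a b : ℕ) :
    (fun a b => (𝒬 a).comp (S0 b)) a (b + 1) = ((fun a b => (𝒬 a).comp (S0 b)) a b).comp (A b) := by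
  simp only [hS0 b, ContinuousLinearMap.comp_assoc]

/-- `R 0 b = S⁰ b`. [folklore] -/
theorem ref_zero_left (S0 : ∀ b, X b →L[ℝ] X 0) (𝒬 : ∀ a, X 0 →L[ℝ] X a)
    (hS00 : S0 0 = ContinuousLinearMap.id ℝ (X 0)) (h𝒬S : ∀ a, (𝒬 a).comp (S0 a) = ContinuousLinearMap.id ℝ (X a)) (b : ℕ) :
    (𝒬 0).comp (S0 b) = S0 b := by
  rw [blocking_zero S0 𝒬 hS00 h𝒬S, ContinuousLinearMap.id_comp]

/-- `(θ^a)⁻¹·θ^b = θ^{b−a}` for `θ ≠ 0`, `a ≤ b`. [folklore] -/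
theorem inv_pow_mul_pow_eq {θ : ℝ} (hθ : θ ≠ 0) {a b : ℕ} (hab : a ≤ b) : (θ ^ a)⁻¹ * θ ^ b = θ ^ (b - a) := by
  rw [pow_sub₀ θ hθ hab]; ring

/-- **PSP's reference letter from one-shot data**: `‖S⁰ b‖ ≤ C·θ^b`, `‖𝒬 a‖ ≤ (θ⁻¹)^a`, `a ≤ b` ⟹ `‖𝒬 a ∘ S⁰ b‖ ≤ C·θ^{b−a}`. [folklore] -/
theorem norm_ref_le (S0 : ∀ b, X b →L[ℝ] X 0) (𝒬 : ∀ a, X 0 →L[ℝ] X a) {C θ : ℝ} (hθ : 0 < θ)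
    (hS : ∀ b, ‖S0 b‖ ≤ C * θ ^ b) (hQ : ∀ a, ‖𝒬 a‖ ≤ θ⁻¹ ^ a) {a b : ℕ} (hab : a ≤ b) :
    ‖(𝒬 a).comp (S0 b)‖ ≤ C * θ ^ (b - a) := by
  calc ‖(𝒬 a).comp (S0 b)‖ ≤ ‖𝒬 a‖ * ‖S0 b‖ := ContinuousLinearMap.opNorm_comp_le _ _
    _ ≤ θ⁻¹ ^ a * (C * θ ^ b) := mul_le_mul (hQ a) (hS b) (norm_nonneg _) (pow_nonneg (inv_nonneg.mpr hθ.le) a)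
    _ = C * θ ^ (b - a) := by
        rw [inv_pow, ← inv_pow_mul_pow_eq hθ.ne' hab]
        ring

/-- **The Duhamel formula against the one-shot family**: `P k = S⁰ k + Σ_{j<k} (P j ∘ (F j − A j)) ∘ (𝒬 (j+1) ∘ S⁰ k)`. [folklore] -/
theorem duhamel_oneShot (P S0 : ∀ k, X k →L[ℝ] X 0) (𝒬 : ∀ a, X 0 →L[ℝ] X a) (F A : ∀ j, X (j + 1) →L[ℝ] X j)
    (hP0 : P 0 = ContinuousLinearMap.id ℝ (X 0)) (hP : ∀ k, P (k + 1) = (P k).comp (F k))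
    (hS00 : S0 0 = ContinuousLinearMap.id ℝ (X 0)) (hS0 : ∀ b, S0 (b + 1) = (S0 b).comp (A b))
    (h𝒬S : ∀ a, (𝒬 a).comp (S0 a) = ContinuousLinearMap.id ℝ (X a)) (k : ℕ) :
    P k = S0 k + ∑ j ∈ range k, ((P j).comp (F j - A j)).comp ((𝒬 (j + 1)).comp (S0 k)) := by
  have h := duhamel P (fun a b => (𝒬 a).comp (S0 b)) F A hP0 hP (ref_self S0 𝒬 h𝒬S)
    (fun a b _ => ref_succ S0 𝒬 A hS0 a b) k
  rw [ref_zero_left S0 𝒬 hS00 h𝒬S] at h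
  exact h

/-! ## §2. Operator-norm letters from the one-shot letter and the blocking norms -/

/-- **THE CONTROLLED PRODUCT FROM ONE-SHOT DATA**: `0 < θ`, `‖S⁰ b‖ ≤ C·θ^b` (every composite reference section from the finest level),
`‖𝒬 a‖ ≤ (θ⁻¹)^a` (every composite blocking), `‖F j − A j‖ ≤ ε_j` ⟹ `‖P k‖ ≤ C·θ^k·∏_{j<k}(1 + C·ε_j∕θ)`. [folklore] -/
theorem norm_le_of_oneShot (P S0 : ∀ k, X k →L[ℝ] X 0) (𝒬 : ∀ a, X 0 →L[ℝ] X a) (F A : ∀ j, X (j + 1) →L[ℝ] X j)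
    (hP0 : P 0 = ContinuousLinearMap.id ℝ (X 0)) (hP : ∀ k, P (k + 1) = (P k).comp (F k))
    (hS0 : ∀ b, S0 (b + 1) = (S0 b).comp (A b)) (h𝒬S : ∀ a, (𝒬 a).comp (S0 a) = ContinuousLinearMap.id ℝ (X a))
    {C θ : ℝ} (hθ : 0 < θ) {ε : ℕ → ℝ} (hS : ∀ b, ‖S0 b‖ ≤ C * θ ^ b) (hQ : ∀ a, ‖𝒬 a‖ ≤ θ⁻¹ ^ a)
    (hε : ∀ j, ‖F j - A j‖ ≤ ε j) (k : ℕ) :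
    ‖P k‖ ≤ C * θ ^ k * ∏ j ∈ range k, (1 + C * ε j / θ) :=
  norm_le_of_consecutive P (fun a b => (𝒬 a).comp (S0 b)) F A hP0 hP (ref_self S0 𝒬 h𝒬S)
    (fun a b _ => ref_succ S0 𝒬 A hS0 a b) hθ (fun _ _ hab => norm_ref_le S0 𝒬 hθ hS hQ hab) hε k

/-- **THE RELATIVE LETTER AGAINST THE ONE-SHOT SECTION**: under the same data (and `S⁰ 0 = 1`),
`‖P k − S⁰ k‖ ≤ C·θ^k·(∏_{j<k}(1 + C·ε_j∕θ) − 1)` — the interacting composite section differs from the FREE ONE-SHOT section by the controlled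
product's excess. [folklore] -/
theorem norm_sub_oneShot_le (P S0 : ∀ k, X k →L[ℝ] X 0) (𝒬 : ∀ a, X 0 →L[ℝ] X a) (F A : ∀ j, X (j + 1) →L[ℝ] X j)
    (hP0 : P 0 = ContinuousLinearMap.id ℝ (X 0)) (hP : ∀ k, P (k + 1) = (P k).comp (F k))
    (hS00 : S0 0 = ContinuousLinearMap.id ℝ (X 0)) (hS0 : ∀ b, S0 (b + 1) = (S0 b).comp (A b))
    (h𝒬S : ∀ a, (𝒬 a).comp (S0 a) = ContinuousLinearMap.id ℝ (X a))
    {C θ : ℝ} (hθ : 0 < θ) {ε : ℕ → ℝ} (hS : ∀ b, ‖S0 b‖ ≤ C * θ ^ b) (hQ : ∀ a, ‖𝒬 a‖ ≤ θ⁻¹ ^ a)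
    (hε : ∀ j, ‖F j - A j‖ ≤ ε j) (k : ℕ) :
    ‖P k - S0 k‖ ≤ C * θ ^ k * (∏ j ∈ range k, (1 + C * ε j / θ) - 1) := by
  have h := norm_sub_le_of_consecutive P (fun a b => (𝒬 a).comp (S0 b)) F A hP0 hP (ref_self S0 𝒬 h𝒬S)
    (fun a b _ => ref_succ S0 𝒬 A hS0 a b) hθ (fun _ _ hab => norm_ref_le S0 𝒬 hθ hS hQ hab) hε k
  rw [ref_zero_left S0 𝒬 hS00 h𝒬S k] at h
  exact h

/-- **GEOMETRIC FORM**: perturbations uniformly `≤ e` ⟹ `‖P k‖ ≤ C·(θ + C·e)^k` — a one-shot decay `θ < 1` of the reference tower survives every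
`e < (1 − θ)∕C`. [folklore] -/
theorem norm_le_geometric_of_oneShot (P S0 : ∀ k, X k →L[ℝ] X 0) (𝒬 : ∀ a, X 0 →L[ℝ] X a) (F A : ∀ j, X (j + 1) →L[ℝ] X j)
    (hP0 : P 0 = ContinuousLinearMap.id ℝ (X 0)) (hP : ∀ k, P (k + 1) = (P k).comp (F k))
    (hS0 : ∀ b, S0 (b + 1) = (S0 b).comp (A b)) (h𝒬S : ∀ a, (𝒬 a).comp (S0 a) = ContinuousLinearMap.id ℝ (X a))
    {C θ e : ℝ} (hθ : 0 < θ) {ε : ℕ → ℝ} (hS : ∀ b, ‖S0 b‖ ≤ C * θ ^ b) (hQ : ∀ a, ‖𝒬 a‖ ≤ θ⁻¹ ^ a)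
    (hε : ∀ j, ‖F j - A j‖ ≤ ε j) (he : ∀ j, ε j ≤ e) (k : ℕ) :
    ‖P k‖ ≤ C * (θ + C * e) ^ k :=
  norm_le_geometric P (fun a b => (𝒬 a).comp (S0 b)) F A hP0 hP (ref_self S0 𝒬 h𝒬S)
    (fun a b _ => ref_succ S0 𝒬 A hS0 a b) hθ (fun _ _ hab => norm_ref_le S0 𝒬 hθ hS hQ hab) hε he k

/-- **k-UNIFORM FORM** (`θ = 1`): blockings of norm `≤ 1`, one-shot sections bounded by `C` at every composite side, summable perturbations
`Σ_{j<k} ε_j ≤ E` ⟹ `‖P k‖ ≤ C·exp(C·E)` FOR EVERY `k`. [folklore] -/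
theorem norm_le_uniform_of_oneShot (P S0 : ∀ k, X k →L[ℝ] X 0) (𝒬 : ∀ a, X 0 →L[ℝ] X a) (F A : ∀ j, X (j + 1) →L[ℝ] X j)
    (hP0 : P 0 = ContinuousLinearMap.id ℝ (X 0)) (hP : ∀ k, P (k + 1) = (P k).comp (F k))
    (hS0 : ∀ b, S0 (b + 1) = (S0 b).comp (A b)) (h𝒬S : ∀ a, (𝒬 a).comp (S0 a) = ContinuousLinearMap.id ℝ (X a))
    {C E : ℝ} {ε : ℕ → ℝ} (hS : ∀ b, ‖S0 b‖ ≤ C) (hQ : ∀ a, ‖𝒬 a‖ ≤ 1)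
    (hε : ∀ j, ‖F j - A j‖ ≤ ε j) (hE : ∀ k, ∑ j ∈ range k, ε j ≤ E) (k : ℕ) :
    ‖P k‖ ≤ C * Real.exp (C * E) :=
  norm_le_uniform_of_summable P (fun a b => (𝒬 a).comp (S0 b)) F A hP0 hP (ref_self S0 𝒬 h𝒬S)
    (fun a b _ => ref_succ S0 𝒬 A hS0 a b)
    (fun a b hab => by
      have h := norm_ref_le S0 𝒬 one_pos (C := C) (fun b => by rw [one_pow, mul_one]; exact hS b)
        (fun a => by rw [inv_one, one_pow]; exact hQ a) hab
      rwa [one_pow, mul_one] at h)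
    hε hE k

/-! ## §3. The second currency -/

/-- The reference letter in a second currency: `p_a(𝒬 a x) ≤ (θ⁻¹)^a·p_0 x` and `p_0(S⁰ b v) ≤ C·θ^b·p_b v` give, for `a ≤ b`,
`p_a((𝒬 a ∘ S⁰ b) v) ≤ C·θ^{b−a}·p_b v`. [folklore] -/
theorem seminorm_ref_le (S0 : ∀ b, X b →L[ℝ] X 0) (𝒬 : ∀ a, X 0 →L[ℝ] X a) (p : ∀ k, Seminorm ℝ (X k)) {C θ : ℝ} (hθ : 0 < θ)
    (hSp : ∀ b v, p 0 (S0 b v) ≤ C * θ ^ b * p b v) (hQp : ∀ a x, p a (𝒬 a x) ≤ θ⁻¹ ^ a * p 0 x) {a b : ℕ} (hab : a ≤ b)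
    (v : X b) : p a (((𝒬 a).comp (S0 b)) v) ≤ C * θ ^ (b - a) * p b v := by
  rw [ContinuousLinearMap.comp_apply]
  calc p a (𝒬 a (S0 b v)) ≤ θ⁻¹ ^ a * p 0 (S0 b v) := hQp a _
    _ ≤ θ⁻¹ ^ a * (C * θ ^ b * p b v) := mul_le_mul_of_nonneg_left (hSp b v) (pow_nonneg (inv_nonneg.mpr hθ.le) a)
    _ = C * θ ^ (b - a) * p b v := by
        rw [inv_pow, ← inv_pow_mul_pow_eq hθ.ne' hab]
        ring

/-- **THE CONTROLLED PRODUCT FROM ONE-SHOT DATA, SECOND CURRENCY**: `p_0(P k v) ≤ C·θ^k·∏_{j<k}(1 + C·ε_j∕θ)·p_k v` from the one-shot seminorm letters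
of `S⁰`, the blocking letters of `𝒬` and the perturbation letters `p_j((F j − A j) v) ≤ ε_j·p_{j+1} v`. [folklore] -/
theorem seminorm_le_of_oneShot (P S0 : ∀ k, X k →L[ℝ] X 0) (𝒬 : ∀ a, X 0 →L[ℝ] X a) (F A : ∀ j, X (j + 1) →L[ℝ] X j)
    (hP0 : P 0 = ContinuousLinearMap.id ℝ (X 0)) (hP : ∀ k, P (k + 1) = (P k).comp (F k))
    (hS0 : ∀ b, S0 (b + 1) = (S0 b).comp (A b)) (h𝒬S : ∀ a, (𝒬 a).comp (S0 a) = ContinuousLinearMap.id ℝ (X a))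
    (p : ∀ k, Seminorm ℝ (X k)) {C θ : ℝ} (hC : 0 ≤ C) (hθ : 0 < θ) {ε : ℕ → ℝ} (hε0 : ∀ j, 0 ≤ ε j)
    (hSp : ∀ b v, p 0 (S0 b v) ≤ C * θ ^ b * p b v) (hQp : ∀ a x, p a (𝒬 a x) ≤ θ⁻¹ ^ a * p 0 x)
    (hεp : ∀ j v, p j ((F j - A j) v) ≤ ε j * p (j + 1) v) :
    ∀ k v, p 0 (P k v) ≤ C * θ ^ k * (∏ j ∈ range k, (1 + C * ε j / θ)) * p k v :=
  seminorm_le_of_consecutive P (fun a b => (𝒬 a).comp (S0 b)) F A hP0 hP (ref_self S0 𝒬 h𝒬S)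
    (fun a b _ => ref_succ S0 𝒬 A hS0 a b) p hC hθ hε0 (fun _ _ hab v => seminorm_ref_le S0 𝒬 p hθ hSp hQp hab v) hεp

/-! ## §4. Toy -/

/-- Toy (kernel): the constant chain `X k = ℝ` with every map the identity and `ε = 0`, read through `norm_le_of_oneShot`'s right side at
`C = θ = 1`: `‖1‖ ≤ 1·1^2·∏_{j<2}(1 + 1·0∕1)`. -/
example : ‖(ContinuousLinearMap.id ℝ ℝ)‖ ≤ 1 * (1 : ℝ) ^ 2 * ∏ _j ∈ range 2, (1 + 1 * (0 : ℝ) / 1) := by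
  norm_num

end Summit.QuantumFields.BalabanUV.T4Continuum.NE7b.PerturbedSectionProductsOneShot
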